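import Summits.BirchSwinnertonDyer.BirchSwinnertonDyer.Theorems.KimAtThreeDeepLowerS24DeepPrimeChoice
import Summits.BirchSwinnertonDyer.Rank1Residual.GaloisImage.SakamotoRankOneAtOne
import Summits.BirchSwinnertonDyer.Rank1Residual.GaloisImage.KolyvaginDeepSubclass
import HarnessLib

/-!
# The `m = 1` slice of the S24-DEEP port is a THEOREM: [S24] Thm. 4.4 (1) for `R = 𝔽₃`, `K = ℚ`
# and a Kolyvagin datum whose primes are the DEEP Frobenius sub-class `frobeniusClassPrimes ρ′ S τ 3^{m′}`
# (route `KimAtThreeKolyvagin`, rung W2; cell `bsd-addord`, seat `bsd-addord-w2-c2` gen 5)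

HONEST FRAMING. ONE theorem (+ one transport helper), no definition, no named fact, no `sorry`; nothing
booked, no mark moved; BSD is not proved by any of this. The flagged port S24-DEEP (1)
(`GaloisImage.S24Deep.kolyvaginSystems_freeRankOne_zmod_three_pow_deep`, FLAG `S24-DEEP-PORT@3`,
`KolyvaginDeepSubclass.lean`) is [S24] Thm. 4.4 (1) over `ℤ/3^m` for a datum whose prime set is the
Chebotarev SUB-class cut out at an independent level `3^{m′} ≥ 3^m` through a deeper module `T′`
(`ker ρ_{T′} ≤ ker ρ_T`), with (H.3′) on `G_{F′}`, `F′ = ℚ(μ_{3^{m′}}, T′)`. Its pinned twin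
(`Sakamoto2024.kolyvaginSystems_freeRankOne_zmod_three_pow`, `T′ = T`, `m′ = m`) has its `m = 1`
slice PROVED in the tree by cell `b2b-bsdres` (team n1011: `GaloisImage.kolyvaginSystems_freeRankOne_zmod_three_pow_at_one`,
from the single-module structure theorem `CoreRankOne.isFreeRankOneZMod_and_bijective_of_coreRankOne`,
whose only uses of the prime set are RESTRICTIVE local shapes + the two Chebotarev supplies `hch3`
(three classes) and `hL52` (four classes, three independent)). This file proves the `m = 1` SLICE
OF THE DEEP PORT the same way: the local shapes at a deep prime are those of the level-`3` class it
lies in (`S24Deep.frobeniusClassPrimes_mono`; n1011's pointwise `…_of_mem_frobeniusClassPrimes`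
lemmas, as in `KolyvaginBaseRigidityDeep`), `hch3` is n1011's deep Cor. 5.5
(`PrimeChoice.…_three_deep`) and `hL52` is this seat's deep Lemma 5.2
(`KimAtThreeDeepLowerS24DeepPrimeChoice.…_four_deep`).

* `h3_of_equiv_pred` — transport of an (H.3)-type vanishing statement along `M ≅ M̄` for ANY
  condition on the group elements (n1011's `Transport.h3_of_equiv` is tied to `ρ u = 1`).
* **`kolyvaginSystems_freeRankOne_zmod_three_pow_deep_at_one`** — the deep port's binders VERBATIM
  with `m := 1`: `KS₁(T/3T, 𝓕, 𝒫′)` is free of rank one over `ℤ/3` and `κ ↦ κ_d` is bijective at every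
  level `d` of the deep datum with `λ^*(d) = 0`. UNCONDITIONAL.
What it is NOT: the port for `m ≥ 2` (its printed half is Mazur–Rubin's principal-artinian theory,
not in the tree; the pinned `m ≥ 2` slices are named facts), nor conclusion (2).

References: R. Sakamoto, JTNB **36** (2024) Thm. 4.4 (1) (p. 926), Lemma 5.2, Cor. 5.5 (pp. 928–930),
§6–§7 [Sakamoto2024]; K. Rubin, PCMI 18 (2011) Cor. 2.8.9 [Rubin2011]; B. Mazur, K. Rubin, Mem. AMS
**799** (2004) §3.5 (H.5), Cor. 4.5.2 (iv), Prop. A.2 [MazurRubin2004].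
-/

set_option autoImplicit false
-- the Theorems namespace of a single-conjunct summit repeats the summit name by design (D-0017)
set_option linter.dupNamespace false

noncomputable section

open scoped Classical NumberField ContRepresentation
open Function Field NumberField IsDedekindDomain
open Literature.NumberTheory.GaloisRepresentations Literature.NumberTheory.GaloisRepresentations.DiscreteGaloisModule
  Literature.NumberTheory.GaloisCohomology
open Summit.BirchSwinnertonDyer.Rank1Residual.GaloisImage.Transport

universe u

namespace Summit.BirchSwinnertonDyer.BirchSwinnertonDyer.Theorems.KimAtThreeDeepLowerS24DeepAtOne

open Summit.BirchSwinnertonDyer.Rank1Residual.GaloisImage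
open Summit.BirchSwinnertonDyer.BirchSwinnertonDyer.Theorems.KimAtThreeDeepLowerS24DeepPrimeChoice

/-! ### A transport helper -/

section Transport

variable {K : Type u} [Field K] {M Mbar : Type u}
  [AddCommGroup M] [TopologicalSpace M] [DiscreteTopology M]
  [AddCommGroup Mbar] [TopologicalSpace Mbar] [DiscreteTopology Mbar]
  {ρ : DiscreteGaloisModule K M} {ρbar : DiscreteGaloisModule K Mbar}
  (e : ρ.toContRepresentation →ⁱL ρbar.toContRepresentation)
  (e' : ρbar.toContRepresentation →ⁱL ρ.toContRepresentation)

/-- **Transport of an (H.3)-shaped vanishing statement along `M ≅ M̄`, for ANY condition `P` on the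
group elements** (n1011's `Transport.h3_of_equiv` with `ρ u = 1` replaced by `P u`; here `P u` will be
`ρ′ u = 1`, the deep group): if every `M̄`-cocycle vanishing on `{u | P u, u ∈ Gal(K̄/K(μ_N))}` is
principal, so is every such `M`-cocycle. [folklore] -/
theorem h3_of_equiv_pred (hee' : ∀ a, e' (e a) = a) (N : ℕ) (P : absoluteGaloisGroup K → Prop)
    (hH3 : ∀ f : contOneCocycles ρbar.toTopRep,
      (∀ u : absoluteGaloisGroup K, P u → u ∈ rootsOfUnityFixer K N → f.1 u = 0) →
        oneCocycleClass ρbar.toTopRep f = 0) :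
    ∀ f : contOneCocycles ρ.toTopRep,
      (∀ u : absoluteGaloisGroup K, P u → u ∈ rootsOfUnityFixer K N → f.1 u = 0) →
        oneCocycleClass ρ.toTopRep f = 0 := by
  intro f hf
  have h0 : galoisCohomology.map e 1 (oneCocycleClass ρ.toTopRep f) = 0 := by
    rw [galoisCohomology.map_one_oneCocycleClass]
    refine hH3 _ fun u hu hμ => ?_
    change e (f.1 u) = 0
    rw [hf u hu hμ, map_zero]
  exact Summit.BirchSwinnertonDyer.Rank1Residual.X11b.Levels.map_injective_of_comp_eq e e' hee'
    (h0.trans (map_zero _).symm)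

end Transport

/-! ### The `m = 1` slice of the deep port -/

/-- **S24-DEEP (1) at `m = 1` is a theorem** — the binders of
`S24Deep.kolyvaginSystems_freeRankOne_zmod_three_pow_deep` VERBATIM with `m := 1`: for a finite discrete
`Γ_ℚ`-module `T` free over `ℤ/3` with residual pair `red`/`incl`, an auxiliary finite `T′` with
`ker ρ_{T′} ≤ ker ρ_T` unramified outside `S`, a level `m′ ≥ 1`, (H.1), (H.2) with `τ ∈ Γ_{ℚ(μ_{3^{m′}})}`,
(H.3′) on `G_{F′} = ker ρ_{T′} ⊓ Gal(ℚ̄/ℚ(μ_{3^{m′}}))`, (H.SD), a Poitou–Tate family, `S ∋ ∞, 3, S_ram`,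
`𝓕` unramified outside `S`, cartesian, of core rank one and residually coisotropic, and a Kolyvagin datum
with primes THE DEEP CLASS `frobeniusClassPrimes ρ_{T′} {v | inr v ∈ S} τ 3^{m′}`, cyclotomic transverse
conditions and canonical comparison maps: `KS₁(T, 𝓕, 𝒫′)` is free of rank one over `ℤ/3^1` and
`κ ↦ κ_d` is bijective at every level `d` with `λ^*(d) = 0`. Proof = n1011's `m = 1` structure theorem
with the deep Chebotarev supplies. [cite: Sakamoto2024, Thm. 4.4 (1) (p. 926), Lemma 5.2 and Cor. 5.5 (pp. 928–930)]
[cite: Rubin2011, Cor. 2.8.9 (2) (p. 25)] [cite: MazurRubin2004, §3.5 (H.5) (p. 27) and Prop. A.2 (pp. 79–80)] -/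
theorem kolyvaginSystems_freeRankOne_zmod_three_pow_deep_at_one
    (M : Type) [AddCommGroup M] [TopologicalSpace M] [DiscreteTopology M] [Finite M]
    (Mbar : Type) [AddCommGroup Mbar] [TopologicalSpace Mbar] [DiscreteTopology Mbar] [Finite Mbar]
    [Module (ZMod (3 ^ 1)) M] [Module.Free (ZMod (3 ^ 1)) M] [Module.Finite (ZMod (3 ^ 1)) M]
    (M' : Type) [AddCommGroup M'] [TopologicalSpace M'] [DiscreteTopology M'] [Finite M'] (m' : ℕ)
    (ρ : DiscreteGaloisModule ℚ M) (ρ' : DiscreteGaloisModule ℚ M') (ρbar : DiscreteGaloisModule ℚ Mbar)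
    (red : ρ.toContRepresentation →ⁱL ρbar.toContRepresentation)
    (incl : ρbar.toContRepresentation →ⁱL ρ.toContRepresentation)
    (τ : absoluteGaloisGroup ℚ)
    (θ : ρbar.toContRepresentation →ⁱL (ρbar.tateDual 3).toContRepresentation)
    (inv : LocalInvariants ℚ 3)
    (S : Finset (Place ℚ)) (𝓕 : SelmerStructure ρ) (D : KolyvaginDatum ρ)
    (η : (q : HeightOneSpectrum (𝓞 ℚ)) → (ZMod (Ideal.absNorm q.asIdeal))ˣ)
    (hm' : 1 ≤ m')
    (hker' : ∀ u : absoluteGaloisGroup ℚ, ρ' u = 1 → ρ u = 1)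
    (hred : Function.Surjective red)
    (_hkerred : ∀ x : M, red x = 0 ↔ ∃ y : M, x = (3 : ℤ) • y)
    (hincl : ∀ x : M, incl (red x) = ((3 : ℤ) ^ (1 - 1)) • x)
    (hirr : ∀ H : AddSubgroup Mbar, (∀ (σ : absoluteGaloisGroup ℚ) (x : Mbar), x ∈ H → ρbar σ x ∈ H) →
      H = ⊥ ∨ H = ⊤)
    (hτμ : τ ∈ rootsOfUnityFixer ℚ (3 ^ m')) (hτq : Nonempty (cokerSubOne ρ τ ≃+ ZMod (3 ^ 1)))
    (hH3 : ∀ f : contOneCocycles ρbar.toTopRep,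
      (∀ u : absoluteGaloisGroup ℚ, ρ' u = 1 → u ∈ rootsOfUnityFixer ℚ (3 ^ m') → f.1 u = 0) →
        oneCocycleClass ρbar.toTopRep f = 0)
    (hθ : Function.Bijective θ)
    (hperf : inv.IsPerfect) (hsum : inv.SumLocalTermEqZero) (hur : inv.UnramifiedOrthogonal)
    (hcompl : inv.SelmerComplement)
    (_hinf : ∀ w : InfinitePlace ℚ, (Sum.inl w : Place ℚ) ∈ S)
    (hS : ∀ v : HeightOneSpectrum (𝓞 ℚ), (Sum.inr v : Place ℚ) ∉ S →
      ((3 : ℕ) : 𝓞 ℚ) ∉ v.asIdeal ∧ GaloisRep.IsUnramifiedAt v ρ)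
    (_hS' : ∀ v : HeightOneSpectrum (𝓞 ℚ), (Sum.inr v : Place ℚ) ∉ S → GaloisRep.IsUnramifiedAt v ρ')
    (h𝓕 : 𝓕.IsUnramifiedOutside S)
    (_hcart : 𝓕.IsCartesian red incl S)
    (hχ : LocalInvariants.HasCoreRank inv (𝓕.induced red) 3 1)
    (hcois : inv.IsResiduallyCoisotropic (𝓕.induced red) θ S)
    (hP : D.primes = frobeniusClassPrimes ρ' {v | (Sum.inr v : Place ℚ) ∈ S} τ (3 ^ m'))
    (hT : D.transverse = cyclotomicTransverse ρ)
    (hD : D.HasCanonicalComparison (3 ^ 1) η) :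
    KolyvaginSystem.IsFreeRankOneZMod (D.kolyvaginSystems 𝓕) (3 ^ 1) ∧
      ∀ (d : Finset (HeightOneSpectrum (𝓞 ℚ))) (hd : D.IsLevel d),
        LocalInvariants.lambdaStar inv ((D.atLevel 𝓕 d).induced red) 3 = 0 →
        Function.Bijective fun κ : D.kolyvaginSystems 𝓕 =>
          (⟨κ.1 d, ((KolyvaginDatum.mem_kolyvaginSystems_iff D 𝓕 κ.1).mp κ.2).mem_selmerGroup d hd⟩ :
            (D.atLevel 𝓕 d).selmerGroup) := by
  haveI : Fact (Nat.Prime 3) := ⟨Nat.prime_three⟩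
  haveI : Fact (Nat.Prime (3 ^ 1)) := ⟨by norm_num⟩
  haveI : NeZero ((3 : ℕ) ^ 1) := ⟨by norm_num⟩
  haveI : NeZero ((3 : ℕ) ^ m') := ⟨pow_ne_zero _ three_ne_zero⟩
  -- `3 · M = 0`
  have hMN : ∀ m : M, (3 ^ 1 : ℕ) • m = 0 := fun m => ZModModule.char_nsmul_eq_zero (3 ^ 1) m
  have hM : ∀ m : M, (3 : ℕ) • m = 0 := fun m => by simpa using hMN m
  have hpD : ∀ y : galoisCohomology (ρ.tateDual 3) 1, 3 • y = 0 := fun y =>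
    galoisCohomology.nsmul_eq_zero_of_forall (ρ.tateDual 3)
      (fun f => DiscreteGaloisModule.TateDual.nsmul_eq_zero f) y
  -- `red` / `incl` are inverse bijections at `m = 1`
  have hee' : ∀ a : M, incl (red a) = a := fun a => by rw [hincl a]; simp
  have he'e : ∀ b : Mbar, red (incl b) = b := fun b => by
    obtain ⟨a, rfl⟩ := hred b
    rw [hee']
  -- the residual self-duality transported to `M`
  set θ' := inverseOfBijective θ hθ with hθ'def
  have hθθ' : ∀ b, θ' (θ b) = b := inverseOfBijective_apply θ hθ
  have hθ'θ : ∀ g, θ (θ' g) = g := fun g => by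
    obtain ⟨b, rfl⟩ := hθ.2 g
    rw [hθθ']
  have hΘΘ' := transportedSelfDual_left_inv red incl θ θ' hee' he'e hθθ'
  have hΘ'Θ := transportedSelfDual_right_inv red incl θ θ' hee' he'e hθ'θ
  -- finiteness of the Selmer group and of the dual Selmer group
  have hfin : Finite 𝓕.selmerGroup :=
    SelmerFinite.finite_selmerGroup_of_isUnramifiedOutside ρ (fun v hv => (hS v hv).2) h𝓕
  have hχM : LocalInvariants.HasCoreRank inv 𝓕 3 1 :=
    (hasCoreRank_induced_iff_comap red incl inv 𝓕 hee' he'e 3 1).mp hχ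
  have hfind : Finite (inv.dualSelmerStructure ρ 𝓕).selmerGroup := by
    have h := hχM
    rw [LocalInvariants.HasCoreRank, pow_one] at h
    refine Nat.finite_of_card_ne_zero fun h0 => ?_
    have h' : Nat.card 𝓕.selmerGroup = 0 := by rw [h, h0, mul_zero]
    exact Nat.card_pos.ne' h'
  have hcoisM := isResiduallyCoisotropic_of_induced_comap red incl inv 𝓕 hee' θ hcois
  -- the deep primes lie in the level-`3` class of `T`, outside `S`
  set S₀ : Set (HeightOneSpectrum (𝓞 ℚ)) := {v | (Sum.inr v : Place ℚ) ∈ S} with hS₀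
  have hS₀fin : S₀.Finite := (S.finite_toSet.preimage Sum.inr_injective.injOn).subset fun v hv => hv
  have hdvd : 3 ^ 1 ∣ 3 ^ m' := pow_dvd_pow 3 hm'
  have hτμ3 : τ ∈ rootsOfUnityFixer ℚ (3 ^ 1) := rootsOfUnityFixer_le_of_dvd ℚ hdvd hτμ
  have hmono : ∀ q ∈ D.primes, q ∈ frobeniusClassPrimes ρ S₀ τ (3 ^ 1) := fun q hq =>
    S24Deep.frobeniusClassPrimes_mono ρ ρ' hker' S₀ τ hdvd (hP ▸ hq)
  have hPS : ∀ q ∈ D.primes, (Sum.inr q : Place ℚ) ∉ S := fun q hq => (hmono q hq).1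
  -- the local shapes at the deep primes (those of the level-`3` class)
  have hprime : ∀ q : HeightOneSpectrum (𝓞 ℚ), Fact (Ideal.absNorm q.asIdeal).Prime :=
    fun q => ⟨FSComp.prime_absNorm_rat q⟩
  have hne : ∀ q : HeightOneSpectrum (𝓞 ℚ),
      NeZero ((Ideal.absNorm q.asIdeal : ℕ) : q.adicCompletion ℚ) := fun q => by
    haveI : CharZero (q.adicCompletion ℚ) :=
      charZero_of_injective_algebraMap (algebraMap ℚ (q.adicCompletion ℚ)).injective
    exact ⟨Nat.cast_ne_zero.2 (FSComp.prime_absNorm_rat q).ne_zero⟩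
  have hM' : ∀ q ∈ D.primes, ∀ m : M, (Ideal.absNorm q.asIdeal - 1) • m = 0 :=
    fun q hq => absNorm_sub_one_smul_eq_zero_of_mem_frobeniusClassPrimes _ (hmono q hq) hτμ3 hMN
  have hU : ∀ q ∈ D.primes, Nat.card (unramifiedSubgroup (GaloisRep.toLocal q ρ) 1) = 3 :=
    fun q hq => (natCard_unramifiedSubgroup_toLocal_of_mem_frobeniusClassPrimes _ (hmono q hq) hτq).trans
      (pow_one 3)
  have hTr : ∀ q ∈ D.primes, Nat.card (D.transverse (Sum.inr q)) = 3 := fun q hq => by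
    haveI := hprime q; haveI := hne q
    rw [hT]
    exact (natCard_cyclotomicTransverse_rat_of_mem_frobeniusClassPrimes' _ (hmono q hq) hτq
      (hM' q hq)).trans (pow_one 3)
  have hUT : ∀ q ∈ D.primes, unramifiedSubgroup (GaloisRep.toLocal q ρ) 1 ⊔
      D.transverse (Sum.inr q) = ⊤ := fun q hq => by
    haveI := hprime q; haveI := hne q
    rw [hT]
    exact unramifiedSubgroup_sup_cyclotomicTransverse_eq_top_of_mem_frobeniusClassPrimes _ (hmono q hq)
      (hM' q hq) (modPCyclotomicCharacter_surjOn_absInertia_rat_holds q)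
  have hTθ : ∀ q ∈ D.primes, (inv.dualLocalCondition ρ (Sum.inr q) (D.transverse (Sum.inr q))).comap
      (localMap ((tateDualComap red).comp (θ.comp red)) (Sum.inr q)) = D.transverse (Sum.inr q) := by
    refine CoreRankOne.comap_dualLocalCondition_transverse_eq_of_transverse_eq
      ((tateDualComap red).comp (θ.comp red)) (incl.comp (θ'.comp (tateDualComap incl)))
      (TransverseCup.transverseOrthogonal_of_isPerfect_of_odd inv (by decide : Odd 3) hperf hur) hM hΘΘ' hT
      (fun q _ => Literature.NumberTheory.Automorphic.Ash2003.residueCard_prime q) (fun q _ => ?_)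
      (fun q hq => hS q (hPS q hq)) (fun q hq => hM' q hq)
      (fun q _ _ _ u => modPCyclotomicCharacter_surjOn_absInertia_rat_holds q u)
    haveI : CharZero (q.adicCompletion ℚ) :=
      charZero_of_injective_algebraMap (algebraMap ℚ (q.adicCompletion ℚ)).injective
    exact Nat.cast_ne_zero.2 (Literature.NumberTheory.Automorphic.Ash2003.residueCard_prime q).ne_zero
  have hadm : D.IsAdmissible :=
    FSComp.isAdmissible_of_hasCanonicalComparison_of_subset ρ (3 ^ 1) S₀ hτq hτμ3
      (fun q hq => hmono q hq) hD
  -- the prime choices on `M` ON THE DEEP CLASS (Chebotarev), through (H.1) and (H.3′) transported to `M`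
  have hirrM := irreducible_of_equiv red incl hee' hirr
  have hH3M := h3_of_equiv_pred red incl hee' (3 ^ m') (fun u => ρ' u = 1) hH3
  have hirrM' : ∀ A : AddSubgroup M,
      (∀ (s : Field.absoluteGaloisGroup ℚ), ∀ m ∈ A, ρ s m ∈ A) → A = ⊥ ∨ A = ⊤ :=
    fun A hA => hirrM A fun s m hm => hA s m hm
  have hτq3 : Nonempty (cokerSubOne ρ τ ≃+ ZMod 3) := by simpa using hτq
  have hch3 : ∀ c₁ c₂ c₃ : galoisCohomology ρ 1, c₁ ≠ 0 → c₂ ≠ 0 → c₃ ≠ 0 →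
      {q ∈ D.primes | galoisCohomology.localization ρ (Sum.inr q) 1 c₁ ≠ 0 ∧
        galoisCohomology.localization ρ (Sum.inr q) 1 c₂ ≠ 0 ∧
        galoisCohomology.localization ρ (Sum.inr q) 1 c₃ ≠ 0}.Infinite := by
    rw [hP]
    exact PrimeChoice.infinite_setOf_mem_frobeniusClassPrimes_localization_ne_zero_three_deep ρ ρ' hker'
      le_rfl (pow_ne_zero _ three_ne_zero) S₀ hS₀fin hτq3 hirrM' hH3M
  have hL52 : ∀ c₁ c₂ c₃ c₄ : galoisCohomology ρ 1,
      (∀ a : Fin 3 → ZMod 3, (∑ i, (a i).val • ![c₁, c₂, c₃] i) = 0 → a = 0) → c₄ ≠ 0 →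
      {q ∈ D.primes | galoisCohomology.localization ρ (Sum.inr q) 1 c₁ ≠ 0 ∧
        galoisCohomology.localization ρ (Sum.inr q) 1 c₂ ≠ 0 ∧
        galoisCohomology.localization ρ (Sum.inr q) 1 c₃ ≠ 0 ∧
        galoisCohomology.localization ρ (Sum.inr q) 1 c₄ ≠ 0}.Infinite := by
    intro c₁ c₂ c₃ c₄ hind hc₄
    rw [hP]
    exact infinite_setOf_mem_frobeniusClassPrimes_localization_ne_zero_four_deep ρ ρ' hker' le_rfl
      (pow_ne_zero _ three_ne_zero) S₀ hS₀fin hτq3 hirrM' hH3M c₁ c₂ c₃ c₄ hind hc₄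
  -- the single-module structure theorem
  have main := CoreRankOne.isFreeRankOneZMod_and_bijective_of_coreRankOne hperf hsum hcompl hur hM hS h𝓕
    hfin hfind _ _ hΘΘ' hΘ'Θ hcoisM hχM hPS hU hTr hUT hTθ hch3 hL52 hadm
  refine ⟨by rw [pow_one]; exact main.1, fun d hd hlam => main.2 d hd ?_⟩
  -- the `λ^*`-clause
  haveI : Finite (inv.dualSelmerStructure ρ (D.atLevel 𝓕 d)).selmerGroup := by
    haveI := CoreRankZero.finite_selmerGroup_atLevel D 𝓕 hfin d
    have h := CoreRankOne.natCard_selmerGroup_atLevel_eq_mul hperf hsum hcompl hM hS h𝓕 hfin hfind hχM hPS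
      hU hTr hd
    refine Nat.finite_of_card_ne_zero fun h0 => ?_
    have h' : Nat.card (D.atLevel 𝓕 d).selmerGroup = 0 := by rw [h, h0, mul_zero]
    exact Nat.card_pos.ne' h'
  exact (lambdaStar_induced_eq_zero_iff_comap red incl inv (D.atLevel 𝓕 d) hee' he'e hpD).mp hlam

end Summit.BirchSwinnertonDyer.BirchSwinnertonDyer.Theorems.KimAtThreeDeepLowerS24DeepAtOne

end
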